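import Literature.MathematicalPhysics.QuantumFieldTheory.Balaban1983to89.Node00.OpsYGauge
import Literature.MathematicalPhysics.QuantumFieldTheory.Balaban1983to89.B9Ineq373HessianPieceBoundsY
import Literature.MathematicalPhysics.QuantumFieldTheory.Balaban1983to89.B16Txt357ThirdOrderNonAbelian

/-!
# `Balaban1983to89.B9TaxiTransportLadder` — the LADDER LEMMA for node00-def-Y's taxicab transporters `U(Γ_{x,x′})` (`Node00.parTaxiV`): the transport
# along the `μ`-SHIFTED contour, conjugated by the two rungs `U_μ(x)`, `U_μ(x′)`, differs from the transport along the contour by the PLAQUETTES of the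
# strip between them — `‖R(U_μ(x)⁻¹·U(Γ_{x,x′})·U_μ(x′))Y − R(U(Γ_{x+e_μ,x′+e_μ}))Y‖ ≤ 2·d·|x − x′|·max_strip ‖U(∂p) − 1‖·‖Y‖` for contraction-valued `U`

T. Bałaban, *Propagators for lattice gauge theories in a background field*, Commun. Math. Phys. **99** (1985) 389–434
[`Balaban1985BackgroundPropagators`, "B9"].

statement-level skeleton of published theorems with citation tags; proofs where landed; nothing here is a claim about the
Yang–Mills mass gap

THE PRINTED LOCI.  [B9] (3.40) p. 397: the Hölder norms transport by *"R(U(Γ_{x,x′})) … where Γ_{x,x′} is a shortest contour connecting points x and x′"*;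
(3.28) p. 395 and p. 398 L19: *"All these inequalities are invariant with respect to gauge transformations of U"*; (3.35) p. 396: the regularity class
bounds the plaquette variables `U(∂p)` (through `|∇^η A|` in the local gauge); (3.3), (3.5) pp. 390–391 (covariant derivative, `U(x′,x) = U(x,x′)⁻¹`).

WHY THIS FILE (cell `pub-ymgap`, node N06, seat dag-n06-l g21; OPTION (2) of the knit's WORD-TZ: *«transported classes + the transported J-letter»*).
The kinematic letter `J_μ(U)λ(b) = −R(U_μ(b₋))λ(b₋ + e_μ)` maps gauge modes to vector fields; its TRANSPORTED Hölder quotient at a near bond pair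
`((s,μ),(s′,μ))` compares `λ` at the shifted sites `s + e_μ, s′ + e_μ` through `W := U_μ(s)⁻¹·U(Γ_{s,s′})·U_μ(s′)`, while the transported site class reads
`U(Γ_{s+e_μ,s′+e_μ})`; the two transports bound the thin strip between the contour and its shift, so they differ by a product of `≤ d·|s − s′|_∞`
plaquette variables — a GAUGE-INVARIANT quantity that (3.35) makes small, replacing the gauge-variant small-gauge binder `hΘ` of the flat letters.
EVERYTHING generic over def-Y's `Node00.OpsYTransport` (`parFwdV ∕ parBwdV ∕ taxiLegV ∕ taxiRun ∕ parTaxiV`) and `Node00.OpsYGauge.gaugeV`, in the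
«action form» `‖R(·)Y‖` ∕ `‖(·)·Y‖` (no `‖1‖ = 1` needed):
* §1 single links: reused from the tree (`B16Txt357ThirdOrderNonAbelian.norm_R_le`, `B9Ineq373HessianPieceBoundsY.norm_R_sub_R_le`);
* §2 ★ `norm_R_parTaxiV_le` — `R(U(Γ))` does not increase norms for a contraction-valued `U` (and `parFwdV ∕ parBwdV ∕ taxiRun` versions);
* §3 ★ `dist_R_parTaxiV_le` — LIPSCHITZ IN THE CONFIGURATION: `‖R(U(Γ_{x,x′}))Y − R(V(Γ_{x,x′}))Y‖ ≤ 2·(d·|x − x′|_∞)·δ·‖Y‖` when the links of `U, V` differ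
  by `≤ δ` at the sites `y` with `|x − y|_∞ ≤ |x − x′|_∞` (the contour stays in that ball: `taxi_ball`);
* §4 ★ `parTaxiV_shift` — SHIFT COVARIANCE `V(Γ_{x+e_μ,x′+e_μ}) = U(Γ_{x,x′})` for `V_ν(y) := U_ν(y − e_μ)`;
* §5 `plaqV` (the plaquette variable `U_μ(z)U_ν(z+e_μ)U_μ(z+e_ν)⁻¹U_ν(z)⁻¹` = def-Y's `holY`), ★ `gaugeV_rung` — dressing by the rung gauge function
  `g(y) := U_μ(y − e_μ)` turns `U` into `p·V`: `(U^g)_ν(y) = plaqV U (y−e_μ) μ ν · U_ν(y − e_μ)`;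
* §6 ★★ `ladder_R_le` — THE LADDER LEMMA (module docstring), from `parTaxiV_gaugeV` (def-Y) + §3–§5.
HONEST SCOPE.  Finite-dimensional algebra over def-Y's landed transporters; nothing of [B9] asserted; no class, no pin; COUNT-NEUTRAL; N06 NOT discharged;
nothing continuum, nothing about the mass gap.  Cell `pub-ymgap` (HUMAN RULING D-0062), Track A node N06 [B9], seat `pub-ymgap-dag-n06-l` (g21), 2026-08-28.
-/

noncomputable section

namespace Literature.MathematicalPhysics.QuantumFieldTheory.Balaban1983to89.B9TaxiTransportLadder

open B9Eq39Adjoint (R)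
open B16Txt357ThirdOrderNonAbelian (norm_R_le)
open B9Ineq373HessianPieceBoundsY (norm_R_sub_R_le)
open B9BackgroundsKLevelV1 (CfgV1)
open LatticeFieldCalculus (supDist)
open Node00 (parFwdV parBwdV taxiLegV taxiRun parTaxiV parFwdV_succ parBwdV_succ gaugeV gaugeV_apply parTaxiV_gaugeV taxiLegV_fst_apply
  taxiRun_fst_apply iterate_shift_apply iterate_unshift_apply)

section Torus

variable {P : Params} {𝔸 : Type} [NormedRing 𝔸]

/-! ## §0 Lattice bookkeeping -/

/-- `(x − e_μ) + e_μ = x`. [cite: Balaban1985BackgroundPropagators, (3.3), (3.5) pp.390–391, bookkeeping] -/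
theorem shift_unshift' (x : Site P 0) (μ : Fin P.d) : (x.unshift μ).shift μ = x := by
  funext ν
  by_cases h : ν = μ
  · subst h; simp [Site.shift, Site.unshift]
  · simp [Site.shift, Site.unshift, h]

/-- `(x + e_μ) − e_μ = x`. [cite: Balaban1985BackgroundPropagators, (3.3), (3.5) pp.390–391, bookkeeping] -/
private theorem unshift_shift' (x : Site P 0) (μ : Fin P.d) : (x.shift μ).unshift μ = x := by
  funext ν
  by_cases h : ν = μ
  · subst h; simp [Site.shift, Site.unshift]
  · simp [Site.shift, Site.unshift, h]

/-- translations commute: `(x + e_μ) + e_ν = (x + e_ν) + e_μ`. [cite: Balaban1985BackgroundPropagators, (3.3) p.391, bookkeeping] -/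
theorem shift_shift_comm (x : Site P 0) (μ ν : Fin P.d) : (x.shift μ).shift ν = (x.shift ν).shift μ := by
  funext κ
  by_cases h1 : κ = ν
  · subst h1
    by_cases h2 : κ = μ
    · subst h2; rfl
    · simp [Site.shift, h2]
  · by_cases h2 : κ = μ
    · subst h2; simp [Site.shift, h1]
    · simp [Site.shift, h1, h2]

/-- `(x − e_μ) + e_ν = (x + e_ν) − e_μ`. [cite: Balaban1985BackgroundPropagators, (3.3) p.391, bookkeeping] -/
theorem unshift_shift_comm (x : Site P 0) (μ ν : Fin P.d) : (x.unshift μ).shift ν = (x.shift ν).unshift μ := by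
  funext κ
  by_cases h1 : κ = ν
  · subst h1
    by_cases h2 : κ = μ
    · subst h2; simp [Site.shift, Site.unshift]
    · simp [Site.shift, Site.unshift, h2]
  · by_cases h2 : κ = μ
    · subst h2; simp [Site.shift, Site.unshift, h1]
    · simp [Site.shift, Site.unshift, h1, h2]

/-- `(x − e_μ) − e_ν = (x − e_ν) − e_μ`. [cite: Balaban1985BackgroundPropagators, (3.3) p.391, bookkeeping] -/
theorem unshift_unshift_comm (x : Site P 0) (μ ν : Fin P.d) : (x.unshift μ).unshift ν = (x.unshift ν).unshift μ := by
  funext κ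
  by_cases h1 : κ = ν
  · subst h1
    by_cases h2 : κ = μ
    · subst h2; rfl
    · simp [Site.unshift, h2]
  · by_cases h2 : κ = μ
    · subst h2; simp [Site.unshift, h1]
    · simp [Site.unshift, h1, h2]

/-- shifting both points by `e_μ` does not change the coordinate differences. [cite: Balaban1982Higgs1, (1.3) p.604, bookkeeping] -/
theorem shift_sub_shift (x x' : Site P 0) (μ ν : Fin P.d) : x'.shift μ ν - x.shift μ ν = x' ν - x ν := by
  by_cases h : ν = μ
  · subst h; simp [Site.shift]
  · simp [Site.shift, h]

/-- `|x + e_μ − (x′ + e_μ)|_∞ = |x − x′|_∞`. [cite: Balaban1982Higgs1, (1.3) p.604, bookkeeping] -/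
theorem supDist_shift (x x' : Site P 0) (μ : Fin P.d) : supDist (x.shift μ) (x'.shift μ) = supDist x x' := by
  unfold supDist
  congr 1; funext ν
  rw [shift_sub_shift, shift_sub_shift]

/-- each coordinate's shorter-way distance is below the sup distance. [cite: Balaban1982Higgs1, (1.3) p.604, bookkeeping] -/
theorem min_val_le_supDist (x y : Site P 0) (ν : Fin P.d) : min (x ν - y ν).val (y ν - x ν).val ≤ supDist x y :=
  Finset.le_sup (f := fun μ : Fin P.d => min (x μ - y μ).val (y μ - x μ).val) (Finset.mem_univ ν)

/-- the sup distance is below a bound iff every coordinate's is. [cite: Balaban1982Higgs1, (1.3) p.604, bookkeeping] -/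
theorem supDist_le_iff (x y : Site P 0) (D : ℕ) : supDist x y ≤ D ↔ ∀ ν, min (x ν - y ν).val (y ν - x ν).val ≤ D := by
  unfold supDist
  rw [Finset.sup_le_iff]
  exact ⟨fun h ν => h ν (Finset.mem_univ ν), fun h ν _ => h ν⟩

/-! ## §1 Single links: conjugation by contractions — reused from the tree (`B16Txt357ThirdOrderNonAbelian.norm_R_le`: ‖R(a)Y‖ ≤ ‖Y‖;
`B9Ineq373HessianPieceBoundsY.norm_R_sub_R_le`: ‖R(a)Y − R(b)Y‖ ≤ 2‖a − b‖‖Y‖, contraction units) -/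

/-! ## §2 The transporters of a contraction-valued configuration do not increase norms (action form) -/

section Contr

variable {U : CfgV1 P 𝔸} (hU : ∀ (ν : Fin P.d) (y : Site P 0), ‖(U ν y : 𝔸)‖ ≤ 1 ∧ ‖(((U ν y)⁻¹ : 𝔸ˣ) : 𝔸)‖ ≤ 1)
include hU

/-- ‖R(U(Γ))Y‖ ≤ ‖Y‖ along a forward straight contour. [cite: Balaban1985BackgroundPropagators, (3.3) p.391, (3.40) p.397, bookkeeping] -/
theorem norm_R_parFwdV_le (μ : Fin P.d) : ∀ (n : ℕ) (x : Site P 0) (Y : 𝔸), ‖R (parFwdV U μ n x) Y‖ ≤ ‖Y‖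
  | 0, x, Y => by simp
  | n + 1, x, Y => by
    rw [parFwdV_succ, B9Eq39Adjoint.R_mul]
    exact (norm_R_le (hU μ x) _).trans (norm_R_parFwdV_le μ n _ Y)

/-- ‖R(U(Γ))Y‖ ≤ ‖Y‖ along a backward straight contour. [cite: Balaban1985BackgroundPropagators, (3.5) p.391, (3.40) p.397, bookkeeping] -/
theorem norm_R_parBwdV_le (μ : Fin P.d) : ∀ (n : ℕ) (x : Site P 0) (Y : 𝔸), ‖R (parBwdV U μ n x) Y‖ ≤ ‖Y‖
  | 0, x, Y => by simp
  | n + 1, x, Y => by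
    rw [parBwdV_succ, B9Eq39Adjoint.R_mul]
    have h := hU μ (x.unshift μ)
    exact (norm_R_le (V := (U μ (x.unshift μ))⁻¹) ⟨h.2, by rw [inv_inv]; exact h.1⟩ _).trans (norm_R_parBwdV_le μ n _ Y)

/-- one taxicab leg keeps the action a contraction. [cite: Balaban1985BackgroundPropagators, (3.40) p.397, bookkeeping] -/
theorem norm_R_taxiLegV_le (x' : Site P 0) {s : Site P 0 × 𝔸ˣ} (hs : ∀ Y : 𝔸, ‖R s.2 Y‖ ≤ ‖Y‖) (μ : Fin P.d) (Y : 𝔸) :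
    ‖R (taxiLegV U x' s μ).2 Y‖ ≤ ‖Y‖ := by
  unfold taxiLegV
  split_ifs
  · rw [B9Eq39Adjoint.R_mul]; exact (hs _).trans (norm_R_parFwdV_le hU μ _ _ Y)
  · rw [B9Eq39Adjoint.R_mul]; exact (hs _).trans (norm_R_parBwdV_le hU μ _ _ Y)

/-- a run of legs keeps the action a contraction. [cite: Balaban1985BackgroundPropagators, (3.40) p.397, bookkeeping] -/
theorem norm_R_taxiRun_le (x' : Site P 0) : ∀ (l : List (Fin P.d)) {s : Site P 0 × 𝔸ˣ} (_ : ∀ Y : 𝔸, ‖R s.2 Y‖ ≤ ‖Y‖) (Y : 𝔸),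
    ‖R (taxiRun U x' l s).2 Y‖ ≤ ‖Y‖
  | [], s, hs, Y => hs Y
  | μ :: l, s, hs, Y => by
    simp only [taxiRun, List.foldl_cons]
    exact norm_R_taxiRun_le x' l (s := taxiLegV U x' s μ) (norm_R_taxiLegV_le hU x' hs μ) Y

/-- ★ **`R(U(Γ_{x,x′}))` DOES NOT INCREASE NORMS** for a contraction-valued configuration. [cite: Balaban1985BackgroundPropagators, (3.40) p.397 («R(U(Γ_{x,x′}))»)] -/
theorem norm_R_parTaxiV_le (x x' : Site P 0) (Y : 𝔸) : ‖R (parTaxiV U x x') Y‖ ≤ ‖Y‖ := by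
  unfold parTaxiV
  exact norm_R_taxiRun_le hU x' _ (fun Y => by simp) Y

end Contr

/-! ## §3 Lipschitz dependence of `R(U(Γ))` on the configuration along the contour -/

section Lip

variable {U V : CfgV1 P 𝔸} (hU : ∀ (ν : Fin P.d) (y : Site P 0), ‖(U ν y : 𝔸)‖ ≤ 1 ∧ ‖(((U ν y)⁻¹ : 𝔸ˣ) : 𝔸)‖ ≤ 1)
  (hV : ∀ (ν : Fin P.d) (y : Site P 0), ‖(V ν y : 𝔸)‖ ≤ 1 ∧ ‖(((V ν y)⁻¹ : 𝔸ˣ) : 𝔸)‖ ≤ 1) {δ : ℝ} (hδ0 : 0 ≤ δ)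
include hU hV hδ0

omit hδ0 in
/-- forward straight contour: if the `μ`-links at `x, x + e_μ, …, x + (n−1)e_μ` differ by `≤ δ`, the actions differ by `≤ 2nδ‖Y‖`.
[cite: Balaban1985BackgroundPropagators, (3.3) p.391, bookkeeping] -/
theorem dist_R_parFwdV_le (μ : Fin P.d) : ∀ (n : ℕ) (x : Site P 0),
    (∀ t < n, ‖(U μ ((fun y : Site P 0 => y.shift μ)^[t] x) : 𝔸) - V μ ((fun y : Site P 0 => y.shift μ)^[t] x)‖ ≤ δ) →
      ∀ Y : 𝔸, ‖R (parFwdV U μ n x) Y - R (parFwdV V μ n x) Y‖ ≤ 2 * n * δ * ‖Y‖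
  | 0, x, _, Y => by simp
  | n + 1, x, h, Y => by
    rw [parFwdV_succ, parFwdV_succ, B9Eq39Adjoint.R_mul, B9Eq39Adjoint.R_mul]
    have h0 : ‖(U μ x : 𝔸) - V μ x‖ ≤ δ := by simpa using h 0 (Nat.succ_pos n)
    have hrest : ∀ t < n, ‖(U μ ((fun y : Site P 0 => y.shift μ)^[t] (x.shift μ)) : 𝔸) -
        V μ ((fun y : Site P 0 => y.shift μ)^[t] (x.shift μ))‖ ≤ δ := fun t ht => by
      have := h (t + 1) (Nat.succ_lt_succ ht)
      rwa [Function.iterate_succ_apply] at this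
    have ih := dist_R_parFwdV_le μ n (x.shift μ) hrest Y
    calc ‖R (U μ x) (R (parFwdV U μ n (x.shift μ)) Y) - R (V μ x) (R (parFwdV V μ n (x.shift μ)) Y)‖
        ≤ ‖R (U μ x) (R (parFwdV U μ n (x.shift μ)) Y) - R (U μ x) (R (parFwdV V μ n (x.shift μ)) Y)‖ +
            ‖R (U μ x) (R (parFwdV V μ n (x.shift μ)) Y) - R (V μ x) (R (parFwdV V μ n (x.shift μ)) Y)‖ := norm_sub_le_norm_sub_add_norm_sub _ _ _
      _ ≤ 2 * n * δ * ‖Y‖ + 2 * δ * ‖Y‖ := by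
          refine add_le_add ?_ ?_
          · rw [← B9Eq39Adjoint.R_sub]; exact (norm_R_le (hU μ x) _).trans ih
          · exact (norm_R_sub_R_le (hU μ x) (hV μ x) _).trans (by
              have h1 := norm_R_parFwdV_le hV μ n (x.shift μ) Y
              nlinarith [norm_nonneg ((U μ x : 𝔸) - V μ x), norm_nonneg Y])
      _ = 2 * (↑(n + 1) : ℝ) * δ * ‖Y‖ := by push_cast; ring

omit hδ0 in
/-- backward straight contour: the same with the links at `x − e_μ, …, x − n e_μ`. [cite: Balaban1985BackgroundPropagators, (3.5) p.391, bookkeeping] -/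
theorem dist_R_parBwdV_le (μ : Fin P.d) : ∀ (n : ℕ) (x : Site P 0),
    (∀ t < n, ‖(U μ ((fun y : Site P 0 => y.unshift μ)^[t + 1] x) : 𝔸) - V μ ((fun y : Site P 0 => y.unshift μ)^[t + 1] x)‖ ≤ δ) →
      ∀ Y : 𝔸, ‖R (parBwdV U μ n x) Y - R (parBwdV V μ n x) Y‖ ≤ 2 * n * δ * ‖Y‖
  | 0, x, _, Y => by simp
  | n + 1, x, h, Y => by
    rw [parBwdV_succ, parBwdV_succ, B9Eq39Adjoint.R_mul, B9Eq39Adjoint.R_mul]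
    have h0 : ‖(U μ (x.unshift μ) : 𝔸) - V μ (x.unshift μ)‖ ≤ δ := by simpa using h 0 (Nat.succ_pos n)
    have hrest : ∀ t < n, ‖(U μ ((fun y : Site P 0 => y.unshift μ)^[t + 1] (x.unshift μ)) : 𝔸) -
        V μ ((fun y : Site P 0 => y.unshift μ)^[t + 1] (x.unshift μ))‖ ≤ δ := fun t ht => by
      have := h (t + 1) (Nat.succ_lt_succ ht)
      rwa [Function.iterate_succ_apply] at this
    have ih := dist_R_parBwdV_le μ n (x.unshift μ) hrest Y
    have hUi : ‖(((U μ (x.unshift μ))⁻¹ : 𝔸ˣ) : 𝔸)‖ ≤ 1 ∧ ‖((((U μ (x.unshift μ))⁻¹)⁻¹ : 𝔸ˣ) : 𝔸)‖ ≤ 1 :=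
      ⟨(hU μ _).2, by rw [inv_inv]; exact (hU μ _).1⟩
    have hVi : ‖(((V μ (x.unshift μ))⁻¹ : 𝔸ˣ) : 𝔸)‖ ≤ 1 ∧ ‖((((V μ (x.unshift μ))⁻¹)⁻¹ : 𝔸ˣ) : 𝔸)‖ ≤ 1 :=
      ⟨(hV μ _).2, by rw [inv_inv]; exact (hV μ _).1⟩
    have hinvd : ‖(((U μ (x.unshift μ))⁻¹ : 𝔸ˣ) : 𝔸) - (((V μ (x.unshift μ))⁻¹ : 𝔸ˣ) : 𝔸)‖ ≤ δ := by
      have heq : (((U μ (x.unshift μ))⁻¹ : 𝔸ˣ) : 𝔸) - (((V μ (x.unshift μ))⁻¹ : 𝔸ˣ) : 𝔸) =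
          (((U μ (x.unshift μ))⁻¹ : 𝔸ˣ) : 𝔸) * ((V μ (x.unshift μ) : 𝔸) - U μ (x.unshift μ)) * (((V μ (x.unshift μ))⁻¹ : 𝔸ˣ) : 𝔸) := by
        rw [mul_sub, sub_mul, Units.mul_inv_cancel_right, Units.inv_mul, one_mul]
      rw [heq]
      calc _ ≤ ‖(((U μ (x.unshift μ))⁻¹ : 𝔸ˣ) : 𝔸) * ((V μ (x.unshift μ) : 𝔸) - U μ (x.unshift μ))‖ * ‖(((V μ (x.unshift μ))⁻¹ : 𝔸ˣ) : 𝔸)‖ :=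
            norm_mul_le _ _
        _ ≤ ‖(((U μ (x.unshift μ))⁻¹ : 𝔸ˣ) : 𝔸)‖ * ‖(V μ (x.unshift μ) : 𝔸) - U μ (x.unshift μ)‖ * ‖(((V μ (x.unshift μ))⁻¹ : 𝔸ˣ) : 𝔸)‖ :=
            mul_le_mul_of_nonneg_right (norm_mul_le _ _) (norm_nonneg _)
        _ ≤ 1 * ‖(V μ (x.unshift μ) : 𝔸) - U μ (x.unshift μ)‖ * 1 := by gcongr <;> [exact (hU μ _).2; exact (hV μ _).2]
        _ ≤ δ := by rw [one_mul, mul_one, norm_sub_rev]; exact h0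
    calc ‖R (U μ (x.unshift μ))⁻¹ (R (parBwdV U μ n (x.unshift μ)) Y) - R (V μ (x.unshift μ))⁻¹ (R (parBwdV V μ n (x.unshift μ)) Y)‖
        ≤ ‖R (U μ (x.unshift μ))⁻¹ (R (parBwdV U μ n (x.unshift μ)) Y) - R (U μ (x.unshift μ))⁻¹ (R (parBwdV V μ n (x.unshift μ)) Y)‖ +
            ‖R (U μ (x.unshift μ))⁻¹ (R (parBwdV V μ n (x.unshift μ)) Y) - R (V μ (x.unshift μ))⁻¹ (R (parBwdV V μ n (x.unshift μ)) Y)‖ :=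
          norm_sub_le_norm_sub_add_norm_sub _ _ _
      _ ≤ 2 * n * δ * ‖Y‖ + 2 * δ * ‖Y‖ := by
          refine add_le_add ?_ ?_
          · rw [← B9Eq39Adjoint.R_sub]; exact (norm_R_le hUi _).trans ih
          · exact (norm_R_sub_R_le hUi hVi _).trans (by
              have h1 := norm_R_parBwdV_le hV μ n (x.unshift μ) Y
              nlinarith [norm_nonneg ((((U μ (x.unshift μ))⁻¹ : 𝔸ˣ) : 𝔸) - (((V μ (x.unshift μ))⁻¹ : 𝔸ˣ) : 𝔸)), norm_nonneg Y])
      _ = 2 * (↑(n + 1) : ℝ) * δ * ‖Y‖ := by push_cast; ring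

/-- the FOLD INVARIANT of the taxicab run from `x` towards `x′`: every coordinate of the running point is that of `x` or that of `x′`.
[cite: Balaban1985BackgroundPropagators, (3.40) p.397, bookkeeping] -/
def Mixed (x x' c : Site P 0) : Prop := ∀ ν, c ν = x ν ∨ c ν = x' ν

omit hU hV hδ0 in
/-- a leg preserves the invariant. [cite: Balaban1985BackgroundPropagators, (3.40) p.397, bookkeeping] -/
theorem Mixed.leg {x x' : Site P 0} {s : Site P 0 × 𝔸ˣ} (h : Mixed x x' s.1) (W : CfgV1 P 𝔸) (μ : Fin P.d) : Mixed x x' (taxiLegV W x' s μ).1 := by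
  intro ν
  rw [taxiLegV_fst_apply]
  split_ifs
  · exact Or.inr rfl
  · exact h ν

omit hU hV hδ0 in
/-- a mixed point lies in the ball `|x − ·|_∞ ≤ |x − x′|_∞`. [cite: Balaban1982Higgs1, (1.3) p.604, bookkeeping] -/
theorem Mixed.supDist_le {x x' c : Site P 0} (h : Mixed x x' c) : supDist x c ≤ supDist x x' := by
  rw [supDist_le_iff]
  intro ν
  rcases h ν with hν | hν
  · rw [hν, sub_self, ZMod.val_zero]; exact (min_le_left _ _).trans (Nat.zero_le _)
  · rw [hν]; exact min_val_le_supDist x x' ν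

omit hU hV hδ0 in
/-- on a leg in direction `μ` from a mixed point, the forward step count is below `|x − x′|_∞`. [cite: Balaban1982Higgs1, (1.3) p.604, bookkeeping] -/
theorem Mixed.fwd_steps_le {x x' c : Site P 0} (h : Mixed x x' c) (μ : Fin P.d) (hle : (x' μ - c μ).val ≤ (c μ - x' μ).val) :
    (x' μ - c μ).val ≤ supDist x x' := by
  rcases h μ with hμ | hμ
  · rw [hμ] at hle ⊢; exact (min_eq_right hle).symm.le.trans (min_val_le_supDist x x' μ)
  · rw [hμ, sub_self, ZMod.val_zero]; exact Nat.zero_le _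

omit hU hV hδ0 in
/-- … and the backward step count likewise. [cite: Balaban1982Higgs1, (1.3) p.604, bookkeeping] -/
theorem Mixed.bwd_steps_le {x x' c : Site P 0} (h : Mixed x x' c) (μ : Fin P.d) (hle : ¬ (x' μ - c μ).val ≤ (c μ - x' μ).val) :
    (c μ - x' μ).val ≤ supDist x x' := by
  rcases h μ with hμ | hμ
  · rw [hμ] at hle ⊢; exact (min_eq_left (not_le.mp hle).le).symm.le.trans (min_val_le_supDist x x' μ)
  · rw [hμ, sub_self, ZMod.val_zero]; exact Nat.zero_le _

omit hU hV hδ0 in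
/-- ★ **THE CONTOUR STAYS IN THE BALL**: a point reached from a mixed point `c` by `t ≤ (x′_μ − c_μ).val` forward steps in direction `μ` (the shorter way)
satisfies `|x − ·|_∞ ≤ |x − x′|_∞`. [cite: Balaban1985BackgroundPropagators, (3.40) p.397 («shortest contour»); Balaban1982Higgs1, (1.3) p.604] -/
theorem taxi_ball_fwd {x x' c : Site P 0} (h : Mixed x x' c) (μ : Fin P.d) (hle : (x' μ - c μ).val ≤ (c μ - x' μ).val) {t : ℕ}
    (ht : t ≤ (x' μ - c μ).val) : supDist x ((fun y : Site P 0 => y.shift μ)^[t] c) ≤ supDist x x' := by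
  rw [supDist_le_iff]
  intro ν
  rw [iterate_shift_apply]
  by_cases hν : ν = μ
  · subst hν
    rw [if_pos rfl]
    have hsteps := h.fwd_steps_le ν hle
    rcases h ν with hc | hc
    · -- c_μ = x_μ: the point is x_μ + t, at forward distance t ≤ steps
      have hlt : t < P.sitesPerDir 0 := lt_of_le_of_lt ht (ZMod.val_lt _)
      rw [hc] at ht hsteps ⊢
      refine (min_le_right _ _).trans ?_
      have : (x ν + (t : ZMod (P.sitesPerDir 0)) - x ν).val = t := by
        rw [add_sub_cancel_left, ZMod.val_natCast, Nat.mod_eq_of_lt hlt]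
      rw [this]; exact ht.trans hsteps
    · -- c_μ = x′_μ: then steps = 0 and t = 0
      have h0 : (x' ν - c ν).val = 0 := by rw [hc, sub_self, ZMod.val_zero]
      have ht0 : t = 0 := Nat.le_zero.mp (h0 ▸ ht)
      subst ht0
      rw [Nat.cast_zero, add_zero, hc]
      exact min_val_le_supDist x x' ν
  · rw [if_neg hν]
    rcases h ν with hc | hc
    · rw [hc, sub_self, ZMod.val_zero]; exact (min_le_left _ _).trans (Nat.zero_le _)
    · rw [hc]; exact min_val_le_supDist x x' ν

omit hU hV hδ0 in
/-- the backward twin of `taxi_ball_fwd` (`t + 1 ≤` backward steps, the point `c − (t+1)e_μ`). [cite: Balaban1985BackgroundPropagators, (3.40) p.397; Balaban1982Higgs1, (1.3) p.604] -/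
theorem taxi_ball_bwd {x x' c : Site P 0} (h : Mixed x x' c) (μ : Fin P.d) (hle : ¬ (x' μ - c μ).val ≤ (c μ - x' μ).val) {t : ℕ}
    (ht : t + 1 ≤ (c μ - x' μ).val) : supDist x ((fun y : Site P 0 => y.unshift μ)^[t + 1] c) ≤ supDist x x' := by
  rw [supDist_le_iff]
  intro ν
  rw [iterate_unshift_apply]
  by_cases hν : ν = μ
  · subst hν
    rw [if_pos rfl]
    have hsteps := h.bwd_steps_le ν hle
    rcases h ν with hc | hc
    · have hlt : t + 1 < P.sitesPerDir 0 := lt_of_le_of_lt ht (ZMod.val_lt _)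
      rw [hc] at ht hsteps ⊢
      refine (min_le_left _ _).trans ?_
      have : (x ν - (x ν - ((t + 1 : ℕ) : ZMod (P.sitesPerDir 0)))).val = t + 1 := by
        rw [sub_sub_cancel, ZMod.val_natCast, Nat.mod_eq_of_lt hlt]
      rw [this]; exact ht.trans hsteps
    · exfalso; rw [hc, sub_self, ZMod.val_zero] at ht; exact Nat.not_succ_le_zero t ht
  · rw [if_neg hν]
    rcases h ν with hc | hc
    · rw [hc, sub_self, ZMod.val_zero]; exact (min_le_left _ _).trans (Nat.zero_le _)
    · rw [hc]; exact min_val_le_supDist x x' ν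

/-- one leg: if the links of `U, V` differ by `≤ δ` on the ball `|x − ·|_∞ ≤ |x − x′|_∞`, the accumulated actions drift by `≤ 2·|x − x′|_∞·δ·‖Y‖` more.
[cite: Balaban1985BackgroundPropagators, (3.40) p.397, bookkeeping] -/
theorem dist_R_taxiLegV_le {x x' : Site P 0} (hδ : ∀ (ν : Fin P.d) (y : Site P 0), supDist x y ≤ supDist x x' → ‖(U ν y : 𝔸) - V ν y‖ ≤ δ)
    {s s' : Site P 0 × 𝔸ˣ} (hs1 : s.1 = s'.1) (hmix : Mixed x x' s.1) (hs : ∀ Y : 𝔸, ‖R s.2 Y‖ ≤ ‖Y‖) {m : ℝ} (hm0 : 0 ≤ m)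
    (hss' : ∀ Y : 𝔸, ‖R s.2 Y - R s'.2 Y‖ ≤ m * ‖Y‖) (μ : Fin P.d) :
    (taxiLegV U x' s μ).1 = (taxiLegV V x' s' μ).1 ∧
      ∀ Y : 𝔸, ‖R (taxiLegV U x' s μ).2 Y - R (taxiLegV V x' s' μ).2 Y‖ ≤ (m + 2 * supDist x x' * δ) * ‖Y‖ := by
  have hD0 : (0 : ℝ) ≤ supDist x x' := Nat.cast_nonneg _
  unfold taxiLegV
  rw [← hs1]
  split_ifs with hle
  · refine ⟨rfl, fun Y => ?_⟩
    simp only [B9Eq39Adjoint.R_mul]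
    have hball : ∀ t < (x' μ - s.1 μ).val, ‖(U μ ((fun y : Site P 0 => y.shift μ)^[t] s.1) : 𝔸) -
        V μ ((fun y : Site P 0 => y.shift μ)^[t] s.1)‖ ≤ δ := fun t ht => hδ μ _ (taxi_ball_fwd hmix μ hle ht.le)
    have hF := dist_R_parFwdV_le hU hV μ _ s.1 hball Y
    have hn : ((x' μ - s.1 μ).val : ℝ) ≤ supDist x x' := by exact_mod_cast hmix.fwd_steps_le μ hle
    calc ‖R s.2 (R (parFwdV U μ (x' μ - s.1 μ).val s.1) Y) - R s'.2 (R (parFwdV V μ (x' μ - s.1 μ).val s.1) Y)‖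
        ≤ ‖R s.2 (R (parFwdV U μ (x' μ - s.1 μ).val s.1) Y) - R s.2 (R (parFwdV V μ (x' μ - s.1 μ).val s.1) Y)‖ +
            ‖R s.2 (R (parFwdV V μ (x' μ - s.1 μ).val s.1) Y) - R s'.2 (R (parFwdV V μ (x' μ - s.1 μ).val s.1) Y)‖ :=
          norm_sub_le_norm_sub_add_norm_sub _ _ _
      _ ≤ 2 * (x' μ - s.1 μ).val * δ * ‖Y‖ + m * ‖Y‖ := by
          refine add_le_add ?_ ?_
          · rw [← B9Eq39Adjoint.R_sub]; exact (hs _).trans hF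
          · exact (hss' _).trans (mul_le_mul_of_nonneg_left (norm_R_parFwdV_le hV μ _ _ Y) hm0)
      _ ≤ (m + 2 * supDist x x' * δ) * ‖Y‖ := by
          have hk : 2 * ((x' μ - s.1 μ).val : ℝ) * δ * ‖Y‖ ≤ 2 * (supDist x x' : ℝ) * δ * ‖Y‖ :=
            mul_le_mul_of_nonneg_right (mul_le_mul_of_nonneg_right (mul_le_mul_of_nonneg_left hn (by norm_num)) hδ0) (norm_nonneg Y)
          linarith
  · refine ⟨rfl, fun Y => ?_⟩
    simp only [B9Eq39Adjoint.R_mul]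
    have hball : ∀ t < (s.1 μ - x' μ).val, ‖(U μ ((fun y : Site P 0 => y.unshift μ)^[t + 1] s.1) : 𝔸) -
        V μ ((fun y : Site P 0 => y.unshift μ)^[t + 1] s.1)‖ ≤ δ := fun t ht => hδ μ _ (taxi_ball_bwd hmix μ hle ht)
    have hF := dist_R_parBwdV_le hU hV μ _ s.1 hball Y
    have hn : ((s.1 μ - x' μ).val : ℝ) ≤ supDist x x' := by exact_mod_cast hmix.bwd_steps_le μ hle
    calc ‖R s.2 (R (parBwdV U μ (s.1 μ - x' μ).val s.1) Y) - R s'.2 (R (parBwdV V μ (s.1 μ - x' μ).val s.1) Y)‖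
        ≤ ‖R s.2 (R (parBwdV U μ (s.1 μ - x' μ).val s.1) Y) - R s.2 (R (parBwdV V μ (s.1 μ - x' μ).val s.1) Y)‖ +
            ‖R s.2 (R (parBwdV V μ (s.1 μ - x' μ).val s.1) Y) - R s'.2 (R (parBwdV V μ (s.1 μ - x' μ).val s.1) Y)‖ :=
          norm_sub_le_norm_sub_add_norm_sub _ _ _
      _ ≤ 2 * (s.1 μ - x' μ).val * δ * ‖Y‖ + m * ‖Y‖ := by
          refine add_le_add ?_ ?_
          · rw [← B9Eq39Adjoint.R_sub]; exact (hs _).trans hF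
          · exact (hss' _).trans (mul_le_mul_of_nonneg_left (norm_R_parBwdV_le hV μ _ _ Y) hm0)
      _ ≤ (m + 2 * supDist x x' * δ) * ‖Y‖ := by
          have hk : 2 * ((s.1 μ - x' μ).val : ℝ) * δ * ‖Y‖ ≤ 2 * (supDist x x' : ℝ) * δ * ‖Y‖ :=
            mul_le_mul_of_nonneg_right (mul_le_mul_of_nonneg_right (mul_le_mul_of_nonneg_left hn (by norm_num)) hδ0) (norm_nonneg Y)
          linarith

/-- a run of legs: the drift accumulates by `2·|x − x′|_∞·δ` per leg. [cite: Balaban1985BackgroundPropagators, (3.40) p.397, bookkeeping] -/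
theorem dist_R_taxiRun_le {x x' : Site P 0} (hδ : ∀ (ν : Fin P.d) (y : Site P 0), supDist x y ≤ supDist x x' → ‖(U ν y : 𝔸) - V ν y‖ ≤ δ) :
    ∀ (l : List (Fin P.d)) {s s' : Site P 0 × 𝔸ˣ} (_ : s.1 = s'.1) (_ : Mixed x x' s.1) (_ : ∀ Y : 𝔸, ‖R s.2 Y‖ ≤ ‖Y‖) {m : ℝ}
      (_ : 0 ≤ m) (_ : ∀ Y : 𝔸, ‖R s.2 Y - R s'.2 Y‖ ≤ m * ‖Y‖),
      ∀ Y : 𝔸, ‖R (taxiRun U x' l s).2 Y - R (taxiRun V x' l s').2 Y‖ ≤ (m + l.length * (2 * supDist x x' * δ)) * ‖Y‖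
  | [], s, s', _, _, _, m, _, hm, Y => by simpa [taxiRun] using hm Y
  | μ :: l, s, s', hs1, hmix, hs, m, hm0, hm, Y => by
    simp only [taxiRun, List.foldl_cons, List.length_cons]
    obtain ⟨h1, h2⟩ := dist_R_taxiLegV_le hU hV hδ0 hδ hs1 hmix hs hm0 hm μ
    have hD0 : (0 : ℝ) ≤ supDist x x' := Nat.cast_nonneg _
    have h := dist_R_taxiRun_le hδ l (s := taxiLegV U x' s μ) (s' := taxiLegV V x' s' μ) h1 (hmix.leg U μ)
      (norm_R_taxiLegV_le hU x' hs μ) (by positivity) h2 Y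
    simp only [taxiRun] at h
    refine h.trans (le_of_eq ?_)
    push_cast; ring

/-- ★ **LIPSCHITZ IN THE CONFIGURATION ALONG THE CONTOUR**: `‖R(U(Γ_{x,x′}))Y − R(V(Γ_{x,x′}))Y‖ ≤ 2·(d·|x − x′|_∞)·δ·‖Y‖` when `‖U_ν(y) − V_ν(y)‖ ≤ δ`
at the sites `y` of the ball `|x − y|_∞ ≤ |x − x′|_∞` (both configurations contraction-valued). [cite: Balaban1985BackgroundPropagators, (3.40) p.397 + (3.28) p.395, bookkeeping] -/
theorem dist_R_parTaxiV_le {x x' : Site P 0} (hδ : ∀ (ν : Fin P.d) (y : Site P 0), supDist x y ≤ supDist x x' → ‖(U ν y : 𝔸) - V ν y‖ ≤ δ)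
    (Y : 𝔸) : ‖R (parTaxiV U x x') Y - R (parTaxiV V x x') Y‖ ≤ 2 * (P.d * supDist x x') * δ * ‖Y‖ := by
  unfold parTaxiV
  have h := dist_R_taxiRun_le hU hV hδ0 hδ (List.finRange P.d) (s := (x, 1)) (s' := (x, 1)) rfl (fun ν => Or.inl rfl) (fun Y => by simp)
    (m := 0) le_rfl (fun Y => by simp) Y
  rw [List.length_finRange] at h
  refine h.trans (le_of_eq ?_)
  ring

end Lip

/-! ## §4 Shift covariance of the taxicab transporter -/

/-- the `μ`-TRANSLATE of a configuration: `(τ_μU)_ν(y) := U_ν(y − e_μ)`. [cite: Balaban1985BackgroundPropagators, (3.3) p.391, dictionary] -/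
def shiftCfg (U : CfgV1 P 𝔸) (μ : Fin P.d) : CfgV1 P 𝔸 := fun ν y => U ν (y.unshift μ)

/-- `(τ_μU)_ν(y) = U_ν(y − e_μ)`. [cite: Balaban1985BackgroundPropagators, (3.3) p.391, dictionary] -/
@[simp] theorem shiftCfg_apply (U : CfgV1 P 𝔸) (μ ν : Fin P.d) (y : Site P 0) : shiftCfg U μ ν y = U ν (y.unshift μ) := rfl

/-- `n` shifts in direction `ν` commute with the shift in direction `μ`. [cite: Balaban1985BackgroundPropagators, (3.3) p.391, bookkeeping] -/
theorem iterate_shift_shift (μ ν : Fin P.d) : ∀ (n : ℕ) (y : Site P 0),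
    (fun z : Site P 0 => z.shift ν)^[n] (y.shift μ) = ((fun z : Site P 0 => z.shift ν)^[n] y).shift μ
  | 0, y => rfl
  | n + 1, y => by rw [Function.iterate_succ_apply, Function.iterate_succ_apply, ← shift_shift_comm, iterate_shift_shift μ ν n]

/-- `n` backward steps in direction `ν` commute with the shift in direction `μ`. [cite: Balaban1985BackgroundPropagators, (3.5) p.391, bookkeeping] -/
theorem iterate_unshift_shift (μ ν : Fin P.d) : ∀ (n : ℕ) (y : Site P 0),
    (fun z : Site P 0 => z.unshift ν)^[n] (y.shift μ) = ((fun z : Site P 0 => z.unshift ν)^[n] y).shift μ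
  | 0, y => rfl
  | n + 1, y => by rw [Function.iterate_succ_apply, Function.iterate_succ_apply, ← unshift_shift_comm, iterate_unshift_shift μ ν n]

/-- the forward transporter of the translate at the shifted point is the original one. [cite: Balaban1985BackgroundPropagators, (3.3) p.391, bookkeeping] -/
theorem parFwdV_shiftCfg (U : CfgV1 P 𝔸) (μ ν : Fin P.d) : ∀ (n : ℕ) (y : Site P 0), parFwdV (shiftCfg U μ) ν n (y.shift μ) = parFwdV U ν n y
  | 0, y => rfl
  | n + 1, y => by rw [parFwdV_succ, parFwdV_succ, shiftCfg_apply, unshift_shift', ← shift_shift_comm, parFwdV_shiftCfg U μ ν n]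

/-- the backward transporter of the translate at the shifted point is the original one. [cite: Balaban1985BackgroundPropagators, (3.5) p.391, bookkeeping] -/
theorem parBwdV_shiftCfg (U : CfgV1 P 𝔸) (μ ν : Fin P.d) : ∀ (n : ℕ) (y : Site P 0), parBwdV (shiftCfg U μ) ν n (y.shift μ) = parBwdV U ν n y
  | 0, y => rfl
  | n + 1, y => by
    rw [parBwdV_succ, parBwdV_succ, shiftCfg_apply, ← unshift_shift_comm, unshift_shift', parBwdV_shiftCfg U μ ν n]

/-- a leg of the translate from the shifted state towards the shifted target is the shifted leg with the same transporter.
[cite: Balaban1985BackgroundPropagators, (3.40) p.397, bookkeeping] -/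
theorem taxiLegV_shiftCfg (U : CfgV1 P 𝔸) (μ : Fin P.d) (x' : Site P 0) (s : Site P 0 × 𝔸ˣ) (ν : Fin P.d) :
    taxiLegV (shiftCfg U μ) (x'.shift μ) (s.1.shift μ, s.2) ν = ((taxiLegV U x' s ν).1.shift μ, (taxiLegV U x' s ν).2) := by
  unfold taxiLegV
  simp only [shift_sub_shift]
  split_ifs
  · simp only [iterate_shift_shift, parFwdV_shiftCfg]
  · simp only [iterate_unshift_shift, parBwdV_shiftCfg]

/-- a run of legs of the translate is the shifted run. [cite: Balaban1985BackgroundPropagators, (3.40) p.397, bookkeeping] -/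
theorem taxiRun_shiftCfg (U : CfgV1 P 𝔸) (μ : Fin P.d) (x' : Site P 0) :
    ∀ (l : List (Fin P.d)) (s : Site P 0 × 𝔸ˣ),
      taxiRun (shiftCfg U μ) (x'.shift μ) l (s.1.shift μ, s.2) = ((taxiRun U x' l s).1.shift μ, (taxiRun U x' l s).2)
  | [], s => rfl
  | ν :: l, s => by
    simp only [taxiRun, List.foldl_cons]
    have h := taxiRun_shiftCfg U μ x' l (taxiLegV U x' s ν)
    simp only [taxiRun] at h
    rw [taxiLegV_shiftCfg, h]

/-- ★ **SHIFT COVARIANCE**: `(τ_μU)(Γ_{x+e_μ,x′+e_μ}) = U(Γ_{x,x′})` — the taxicab contour between the shifted points is the shifted contour.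
[cite: Balaban1985BackgroundPropagators, (3.3) p.391, (3.40) p.397] -/
theorem parTaxiV_shift (U : CfgV1 P 𝔸) (μ : Fin P.d) (x x' : Site P 0) : parTaxiV (shiftCfg U μ) (x.shift μ) (x'.shift μ) = parTaxiV U x x' := by
  unfold parTaxiV
  have h := taxiRun_shiftCfg U μ x' (List.finRange P.d) (x, 1)
  simp only at h
  rw [h]

/-! ## §5 The plaquette variables and the rung gauge function -/

/-- the PLAQUETTE VARIABLE `U(∂p) = U_μ(z)U_ν(z+e_μ)U_μ(z+e_ν)⁻¹U_ν(z)⁻¹` at `z` in the (ordered) plane `(μ, ν)` (= node00-def-Y's `holY` for `μ < ν`;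
`= 1` for `μ = ν`). [cite: Balaban1985BackgroundPropagators, (3.6)–(3.7) p.391] -/
def plaqV (U : CfgV1 P 𝔸) (z : Site P 0) (μ ν : Fin P.d) : 𝔸ˣ := U μ z * U ν (z.shift μ) * (U μ (z.shift ν))⁻¹ * (U ν z)⁻¹

/-- the RUNG gauge function `g(y) := U_μ(y − e_μ)`. [cite: Balaban1985BackgroundPropagators, (3.28) p.395, dictionary] -/
def rungGauge (U : CfgV1 P 𝔸) (μ : Fin P.d) : Site P 0 → 𝔸ˣ := fun y => U μ (y.unshift μ)

/-- ★ **DRESSING BY THE RUNGS**: `(U^g)_ν(y) = U(∂p_{y−e_μ;μ,ν})·U_ν(y − e_μ)` for `g(y) = U_μ(y − e_μ)` — the gauge transform by the rungs is the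
translate times the plaquette variables of the strip. [cite: Balaban1985BackgroundPropagators, (3.28) p.395 + (3.6) p.391] -/
theorem gaugeV_rung (U : CfgV1 P 𝔸) (μ ν : Fin P.d) (y : Site P 0) :
    gaugeV (rungGauge U μ) U ν y = plaqV U (y.unshift μ) μ ν * shiftCfg U μ ν y := by
  rw [gaugeV_apply]
  show U μ (y.unshift μ) * U ν y * (U μ ((y.shift ν).unshift μ))⁻¹ =
    U μ (y.unshift μ) * U ν ((y.unshift μ).shift μ) * (U μ ((y.unshift μ).shift ν))⁻¹ * (U ν (y.unshift μ))⁻¹ * U ν (y.unshift μ)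
  rw [shift_unshift', unshift_shift_comm, inv_mul_cancel_right]

/-- the dressed links differ from the translated ones by the plaquette deviation: `‖(U^g)_ν(y) − (τ_μU)_ν(y)‖ ≤ ‖U(∂p) − 1‖` (contraction links).
[cite: Balaban1985BackgroundPropagators, (3.35) p.396 + (3.6) p.391, bookkeeping] -/
theorem norm_gaugeV_rung_sub_le {U : CfgV1 P 𝔸} (hU : ∀ (ν : Fin P.d) (y : Site P 0), ‖(U ν y : 𝔸)‖ ≤ 1 ∧ ‖(((U ν y)⁻¹ : 𝔸ˣ) : 𝔸)‖ ≤ 1)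
    (μ ν : Fin P.d) (y : Site P 0) :
    ‖(gaugeV (rungGauge U μ) U ν y : 𝔸) - shiftCfg U μ ν y‖ ≤ ‖(plaqV U (y.unshift μ) μ ν : 𝔸) - 1‖ := by
  rw [gaugeV_rung, Units.val_mul]
  have h : (plaqV U (y.unshift μ) μ ν : 𝔸) * (shiftCfg U μ ν y : 𝔸) - shiftCfg U μ ν y =
      ((plaqV U (y.unshift μ) μ ν : 𝔸) - 1) * (shiftCfg U μ ν y : 𝔸) := by rw [sub_mul, one_mul]
  rw [h]
  exact (norm_mul_le _ _).trans (mul_le_of_le_one_right (norm_nonneg _) (by rw [shiftCfg_apply]; exact (hU ν _).1))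

/-! ## §6 ★★ The ladder lemma -/

/-- ★★ **THE LADDER LEMMA**: for a contraction-valued configuration and `‖U(∂p) − 1‖ ≤ θ` on the plaquettes `p_{y−e_μ;μ,ν}` with `y` in the ball
`|x + e_μ − y|_∞ ≤ |x − x′|_∞` (the strip between `Γ_{x,x′}` and its shift), for every `Y`:
`‖R(U_μ(x)⁻¹·U(Γ_{x,x′})·U_μ(x′))Y − R(U(Γ_{x+e_μ,x′+e_μ}))Y‖ ≤ 2·(d·|x − x′|_∞)·θ·‖Y‖` — the two transports from `x′ + e_μ` to `x + e_μ` differ by the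
plaquettes of the strip, a GAUGE-INVARIANT defect. [cite: Balaban1985BackgroundPropagators, (3.40) p.397 + (3.28) p.395 + (3.35) p.396 + (3.3), (3.5) pp.390–391] -/
theorem ladder_R_le {U : CfgV1 P 𝔸} (hU : ∀ (ν : Fin P.d) (y : Site P 0), ‖(U ν y : 𝔸)‖ ≤ 1 ∧ ‖(((U ν y)⁻¹ : 𝔸ˣ) : 𝔸)‖ ≤ 1)
    {θ : ℝ} (hθ0 : 0 ≤ θ) (μ : Fin P.d) {x x' : Site P 0}
    (hθ : ∀ (ν : Fin P.d) (y : Site P 0), supDist (x.shift μ) y ≤ supDist x x' → ‖(plaqV U (y.unshift μ) μ ν : 𝔸) - 1‖ ≤ θ) (Y : 𝔸) :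
    ‖R ((U μ x)⁻¹ * parTaxiV U x x' * U μ x') Y - R (parTaxiV U (x.shift μ) (x'.shift μ)) Y‖ ≤ 2 * (P.d * supDist x x') * θ * ‖Y‖ := by
  -- the shifted contour through the rung gauge: `U(Γ_shift) = U_μ(x)⁻¹·(U^g)(Γ_shift)·U_μ(x′)`
  have hg := parTaxiV_gaugeV (rungGauge U μ) U (x.shift μ) (x'.shift μ)
  rw [rungGauge, rungGauge, unshift_shift', unshift_shift'] at hg
  have hshift : parTaxiV U (x.shift μ) (x'.shift μ) = (U μ x)⁻¹ * parTaxiV (gaugeV (rungGauge U μ) U) (x.shift μ) (x'.shift μ) * U μ x' := by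
    rw [hg]; group
  -- the unshifted contour as the translate's shifted contour
  have hV : parTaxiV U x x' = parTaxiV (shiftCfg U μ) (x.shift μ) (x'.shift μ) := (parTaxiV_shift U μ x x').symm
  rw [hshift, hV, B9Eq39Adjoint.R_mul, B9Eq39Adjoint.R_mul, B9Eq39Adjoint.R_mul, B9Eq39Adjoint.R_mul, ← B9Eq39Adjoint.R_sub]
  have hUi : ‖(((U μ x)⁻¹ : 𝔸ˣ) : 𝔸)‖ ≤ 1 ∧ ‖((((U μ x)⁻¹)⁻¹ : 𝔸ˣ) : 𝔸)‖ ≤ 1 := ⟨(hU μ x).2, by rw [inv_inv]; exact (hU μ x).1⟩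
  refine (norm_R_le hUi _).trans ?_
  -- Lipschitz between the translate and the dressed configuration along the shifted contour
  have hVc : ∀ (ν : Fin P.d) (y : Site P 0), ‖(shiftCfg U μ ν y : 𝔸)‖ ≤ 1 ∧ ‖(((shiftCfg U μ ν y)⁻¹ : 𝔸ˣ) : 𝔸)‖ ≤ 1 :=
    fun ν y => by rw [shiftCfg_apply]; exact hU ν _
  have hGc : ∀ (ν : Fin P.d) (y : Site P 0), ‖(gaugeV (rungGauge U μ) U ν y : 𝔸)‖ ≤ 1 ∧ ‖(((gaugeV (rungGauge U μ) U ν y)⁻¹ : 𝔸ˣ) : 𝔸)‖ ≤ 1 := by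
    intro ν y
    rw [gaugeV_apply, rungGauge, rungGauge]
    refine ⟨?_, ?_⟩
    · rw [Units.val_mul, Units.val_mul]
      calc _ ≤ ‖(U μ (y.unshift μ) : 𝔸) * U ν y‖ * ‖(((U μ ((y.shift ν).unshift μ))⁻¹ : 𝔸ˣ) : 𝔸)‖ := norm_mul_le _ _
        _ ≤ ‖(U μ (y.unshift μ) : 𝔸)‖ * ‖(U ν y : 𝔸)‖ * ‖(((U μ ((y.shift ν).unshift μ))⁻¹ : 𝔸ˣ) : 𝔸)‖ := mul_le_mul_of_nonneg_right (norm_mul_le _ _) (norm_nonneg _)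
        _ ≤ 1 * 1 * 1 := by gcongr <;> [exact (hU μ _).1; exact (hU ν y).1; exact (hU μ _).2]
        _ = 1 := by ring
    · rw [mul_inv_rev, mul_inv_rev, inv_inv, Units.val_mul, Units.val_mul]
      calc _ ≤ ‖(U μ ((y.shift ν).unshift μ) : 𝔸)‖ * ‖(((U ν y)⁻¹ : 𝔸ˣ) : 𝔸) * (((U μ (y.unshift μ))⁻¹ : 𝔸ˣ) : 𝔸)‖ := norm_mul_le _ _
        _ ≤ ‖(U μ ((y.shift ν).unshift μ) : 𝔸)‖ * (‖(((U ν y)⁻¹ : 𝔸ˣ) : 𝔸)‖ * ‖(((U μ (y.unshift μ))⁻¹ : 𝔸ˣ) : 𝔸)‖) :=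
            mul_le_mul_of_nonneg_left (norm_mul_le _ _) (norm_nonneg _)
        _ ≤ 1 * (1 * 1) := by gcongr <;> [exact (hU μ _).1; exact (hU ν y).2; exact (hU μ _).2]
        _ = 1 := by ring
  have hδ : ∀ (ν : Fin P.d) (y : Site P 0), supDist (x.shift μ) y ≤ supDist (x.shift μ) (x'.shift μ) →
      ‖(shiftCfg U μ ν y : 𝔸) - gaugeV (rungGauge U μ) U ν y‖ ≤ θ := fun ν y hy => by
    rw [norm_sub_rev]
    rw [supDist_shift] at hy
    exact (norm_gaugeV_rung_sub_le hU μ ν y).trans (hθ ν y hy)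
  have h := dist_R_parTaxiV_le hVc hGc hθ0 hδ (R (U μ x') Y)
  rw [supDist_shift] at h
  refine h.trans (mul_le_mul_of_nonneg_left (norm_R_le (hU μ x') Y) ?_)
  have : (0 : ℝ) ≤ supDist x x' := Nat.cast_nonneg _
  positivity

end Torus

end Literature.MathematicalPhysics.QuantumFieldTheory.Balaban1983to89.B9TaxiTransportLadder
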